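import Summits.ResolutionOfSingularities.ResolutionOfSingularities.Theorems.FrobeniusLadderFInjectiveMacaulayficationClauseOfMaximal
import Summits.ResolutionOfSingularities.ResolutionOfSingularities.Theorems.FrobeniusLadderFInjectiveMacaulayficationNonFullLoopFrame
import Summits.ResolutionOfSingularities.ResolutionOfSingularities.Theorems.FrobeniusLadderFInjectiveMacaulayficationNonFullLoopFloorOne
import Literature.RingTheory.MvPolynomial.VariableIdeals
import Mathlib.Algebra.DualNumber
import HarnessLib

/-!
# NEG-N, FLOOR 5 (the period-one N-loop germ `U₀`), CENTRE SIDE: `𝔮 = (x̄, ȳ, z̄) ⊂ k[x,y,u,t,z]/(g₅)` is a height-two prime and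
# EVERY point of `V(𝔮)` is NON-FULL — the «⊇» half of the two-sided locus lemma `hlocus` of res-L1-w45a-lead-1's (L-g) frame
# (crux `FInjectiveMacaulayfication` stmt-ResolutionOfSingularities-15315, chain w45a; res-L1-w45a-plan-1 g19 RULINGS R19.21 «NEG-N: an unconditional
# kernel refutation of `Recipes.NonFullTowerConjecture` on the period-one bed d4lx6c3» / R19.22 (floor split: NEG-1, NEG-3, NEG-5 → stub-1); floor table =
# res-L1-w45a-tri-2 g16's replay l.81567 (`k = 5: g₅ = z² + x²yz + xy²(1+u³+t³), I₁ = (x, y, yt, yu, z), S₅ = (x, y, z)`); letters and the shape of `hlocus`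
# = res-L1-w45a-lead-1 (L-g) `…NonFullLoopFrame` l.81722; seat res-L1-w45a-stub-1 g12; pattern = this seat's `TauFloorOneCIChartNotFull` (p617516))

[OURS · L1 W4.5a] Support file (`--supports stmt-ResolutionOfSingularities-15315 --as helper`); replaces the role of NO printed item; NOT a statement of any
manuscript; def-free (the floor polynomial is a hypothesis `g` with its defining equation, in lead-1's letters); UNCONDITIONAL. §1–§3 over ANY field; §4
`CharP k 2`. Sequel of res-L1-w45a-lead-1's ✓ p645060 `…NonFullLoopFrame` (its §1–§2 ring facts are imported, not restated). AI-written (AI review is weaker than expert review).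

`X 0 = x`, `X 1 = y`, `X 2 = u`, `X 3 = t`, `X 4 = z`; `g₅ = X 4 ^ 2 + X 0 ^ 2 * X 1 * X 4 + X 0 * X 1 ^ 2 * X 2 ^ 3 + X 0 * X 1 ^ 2 * X 3 ^ 3 + X 0 * X 1 ^ 2`,
`A = k[X]/(g₅)`, `U₀ = Spec A`; the centre `𝔮 = (x̄, ȳ, z̄)` is spelled `Ideal.span ((fun j => mk (X j)) '' ↑({0, 1, 4} : Finset (Fin 5)))` (lead-1's spelling).
* §1 ring facts (primality `prime_g5` / `isPrime_span_g5` / `isPrime_centre` are res-L1-w45a-lead-1's ✓ p645060 `NonFullLoopFrame`, imported): `not_X_dvd_g₅`,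
  `g₅_ne_zero`, `g₅_mem_span_X_image` (`g₅ ∈ (x, y, z)` and `∈ (x, z)`), ★ `mk_X4_sq` (`z̄² = −x̄²ȳz̄ − x̄ȳ²(u³+t³+1)` in `A`);
* §2 coordinate primes of `A`: `span_image_mk_eq_map` (any `s`; lead-1's `span_centre_eq_map` is the case `s = {0,1,4}`), `isPrime_span_image_mk` (`(x̄ⱼ : j ∈ s)`
  is prime once `g₅ ∈ (xⱼ : j ∈ s)`; Literature `isPrime_span_X_image`), `mk_X_mem_span_image_iff` (`x̄ᵢ ∈ (x̄ⱼ : j ∈ s) ↔ i ∈ s`), ★ `height_centre :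
  height 𝔮 = 2` (`≤`: `𝔮` is minimal over `(x̄, ȳ)` since `z̄² ∈ (x̄)`, Krull; `≥`: the chain `⊥ < (x̄, z̄) < 𝔮` of primes);
* §3 ★★ `not_fullCl_atPrime_centre` — `¬ FullCl 2 (A_𝔮)` over ANY field: `dim A_𝔮 = 2`, `(x̄, ȳ)` is a system of parameters (`z̄² ∈ (x̄)`),
  **`z̄² = x̄²·(ȳz̄) + ȳ²·(x̄(1+u³+t³)) ∈ (x̄, ȳ)^{[2]}` but `z̄ ∉ (x̄, ȳ)A_𝔮`** — the witness map `A_𝔮 → F[ε]` (`F = Frac k[X]`; `x, y ↦ 0`, `z ↦ ε`,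
  `u, t ↦ u, t`) kills `g₅` and `(x̄, ȳ)`, sends `A ∖ 𝔮` to units and `z̄` to `ε ≠ 0` (tri-2 l.81567: `I₁(g₅) = (x, y, yt, yu, z) ⊆ 𝔮`, the dim-2 Frobenius witness);
* §4 ★★ `not_fullCl_stalk_of_centre_le` (`CharP k 2`) — **`¬ FullCl 2 𝒪_{U₀,w}` for EVERY point `w ⊇ 𝔮`**: FULL at `w` would localize to FULL at `𝔮`
  (`ClauseOfMaximal.fiClause_atPrime_of_le`) — THE «⊇» HALF of `hlocus`; `not_fullCl_localization_of_centre_le` (localization form).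
The «⊆» half (FULL at every point off `V(𝔮)`: three off-centre Fedder cells `x² · yz`, `y² · x`, `z² · 1`) and the `↔` in lead-1's letters are the sequel
`…NonFullLoopFloorFive`. [cite: Fedder1983, Prop. 1.7 (context)] [cite: Matsumura1987, Thm. 13.5]
-/

-- single-problem summit: the doubled namespace component is forced
set_option linter.dupNamespace false

noncomputable section

open AlgebraicGeometry CategoryTheory Literature.AlgebraicGeometry.Resolution TopologicalSpace IsLocalRing MvPolynomial DualNumber

namespace Summit.ResolutionOfSingularities.ResolutionOfSingularities.Theorems.FInjectiveMacaulayfication.NonFullLoopFloorFive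

open Summit.ResolutionOfSingularities.ResolutionOfSingularities.Theorems.FInjectiveMacaulayfication
open SliceableCentre

variable (k : Type) [Field k]

/-! ## §1 Ring facts on `g₅` -/

/-- No variable divides `g₅` (`g₅(e_z) = 1`; `g₅(1,1,0,0,0) = 1`). [certificate] -/
theorem not_X_dvd_g₅ (g : MvPolynomial (Fin 5) k) (hg : g = X 4 ^ 2 + X 0 ^ 2 * X 1 * X 4 + X 0 * X 1 ^ 2 * X 2 ^ 3 + X 0 * X 1 ^ 2 * X 3 ^ 3 + X 0 * X 1 ^ 2)
    (i : Fin 5) : ¬ ((X i : MvPolynomial (Fin 5) k) ∣ g) := by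
  rintro ⟨c, hc⟩
  by_cases hi : i = 4
  · subst hi
    have := congrArg (MvPolynomial.eval ![(1 : k), 1, 0, 0, 0]) hc
    rw [hg] at this
    simp at this
  · have := congrArg (MvPolynomial.eval (Pi.single 4 1 : Fin 5 → k)) hc
    rw [hg] at this
    simp [hi] at this

/-- `g₅ ≠ 0`. [plumbing] -/
theorem g₅_ne_zero (g : MvPolynomial (Fin 5) k) (hg : g = X 4 ^ 2 + X 0 ^ 2 * X 1 * X 4 + X 0 * X 1 ^ 2 * X 2 ^ 3 + X 0 * X 1 ^ 2 * X 3 ^ 3 + X 0 * X 1 ^ 2) :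
    g ≠ 0 :=
  (NonFullLoopFrame.prime_g5 k g hg).ne_zero

/-- `g₅ ∈ (xⱼ : j ∈ s)` as soon as `0, 4 ∈ s` (`g₅ = z·(z + x²y) + x·y²(u³+t³+1)`). [folklore] -/
theorem g₅_mem_span_X_image (g : MvPolynomial (Fin 5) k) (hg : g = X 4 ^ 2 + X 0 ^ 2 * X 1 * X 4 + X 0 * X 1 ^ 2 * X 2 ^ 3 + X 0 * X 1 ^ 2 * X 3 ^ 3 + X 0 * X 1 ^ 2)
    (s : Set (Fin 5)) (h0 : (0 : Fin 5) ∈ s) (h4 : (4 : Fin 5) ∈ s) : g ∈ Ideal.span (X '' s : Set (MvPolynomial (Fin 5) k)) := by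
  have hx : (X 0 : MvPolynomial (Fin 5) k) ∈ Ideal.span (X '' s : Set (MvPolynomial (Fin 5) k)) := Ideal.subset_span ⟨0, h0, rfl⟩
  have hz : (X 4 : MvPolynomial (Fin 5) k) ∈ Ideal.span (X '' s : Set (MvPolynomial (Fin 5) k)) := Ideal.subset_span ⟨4, h4, rfl⟩
  have hdec : g = X 4 * (X 4 + X 0 ^ 2 * X 1) + X 0 * (X 1 ^ 2 * X 2 ^ 3 + X 1 ^ 2 * X 3 ^ 3 + X 1 ^ 2) := by rw [hg]; ring
  rw [hdec]
  exact Ideal.add_mem _ (Ideal.mul_mem_right _ _ hz) (Ideal.mul_mem_right _ _ hx)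

/-- ★ In `A = k[X]/(g₅)`: `z̄² = −x̄²ȳz̄ − x̄ȳ²(ū³+t̄³+1)`. [certificate] -/
theorem mk_X4_sq (g : MvPolynomial (Fin 5) k) (hg : g = X 4 ^ 2 + X 0 ^ 2 * X 1 * X 4 + X 0 * X 1 ^ 2 * X 2 ^ 3 + X 0 * X 1 ^ 2 * X 3 ^ 3 + X 0 * X 1 ^ 2) :
    Ideal.Quotient.mk (Ideal.span {g}) (X 4) ^ 2 =
      -(Ideal.Quotient.mk (Ideal.span {g}) (X 0) ^ 2 * Ideal.Quotient.mk (Ideal.span {g}) (X 1) * Ideal.Quotient.mk (Ideal.span {g}) (X 4)) -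
        Ideal.Quotient.mk (Ideal.span {g}) (X 0) * Ideal.Quotient.mk (Ideal.span {g}) (X 1) ^ 2 *
          (Ideal.Quotient.mk (Ideal.span {g}) (X 2) ^ 3 + Ideal.Quotient.mk (Ideal.span {g}) (X 3) ^ 3 + 1) := by
  have h0 : Ideal.Quotient.mk (Ideal.span {g}) g = 0 := Ideal.Quotient.eq_zero_iff_mem.mpr (Ideal.subset_span rfl)
  have hid : (X 4 : MvPolynomial (Fin 5) k) ^ 2 = -(X 0 ^ 2 * X 1 * X 4) - X 0 * X 1 ^ 2 * (X 2 ^ 3 + X 3 ^ 3 + 1) + g := by rw [hg]; ring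
  have h1 := congrArg (Ideal.Quotient.mk (Ideal.span {g})) hid
  rw [map_add, h0, add_zero] at h1
  simpa only [map_sub, map_neg, map_mul, map_pow, map_add, map_one] using h1

/-! ## §2 Coordinate primes of `A = k[X]/(g₅)`; the height of the centre -/

/-- The ideal `(x̄ⱼ : j ∈ s)` of `A` is the image of `(xⱼ : j ∈ s)`. [folklore] -/
theorem span_image_mk_eq_map (g : MvPolynomial (Fin 5) k) (s : Set (Fin 5)) :
    Ideal.span ((fun j : Fin 5 => Ideal.Quotient.mk (Ideal.span {g}) (X j)) '' s) =
      (Ideal.span (X '' s : Set (MvPolynomial (Fin 5) k))).map (Ideal.Quotient.mk (Ideal.span {g})) := by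
  rw [Ideal.map_span, Set.image_image]

/-- `(x̄ⱼ : j ∈ s) ⊂ A` is PRIME whenever `g₅ ∈ (xⱼ : j ∈ s)` (`A/(x̄ⱼ) = k[X]/(xⱼ : j ∈ s)`, a polynomial ring). [folklore; Literature `isPrime_span_X_image`] -/
theorem isPrime_span_image_mk (g : MvPolynomial (Fin 5) k) (s : Set (Fin 5)) (hgs : g ∈ Ideal.span (X '' s : Set (MvPolynomial (Fin 5) k))) :
    (Ideal.span ((fun j : Fin 5 => Ideal.Quotient.mk (Ideal.span {g}) (X j)) '' s)).IsPrime := by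
  rw [span_image_mk_eq_map]
  haveI := Literature.RingTheory.MvPolynomial.isPrime_span_X_image (R := k) s
  refine Ideal.map_isPrime_of_surjective Ideal.Quotient.mk_surjective ?_
  rw [Ideal.mk_ker, Ideal.span_le, Set.singleton_subset_iff]
  exact hgs

/-- `x̄ᵢ ∈ (x̄ⱼ : j ∈ s) ↔ i ∈ s` (when `g₅ ∈ (xⱼ : j ∈ s)`). [folklore] -/
theorem mk_X_mem_span_image_iff (g : MvPolynomial (Fin 5) k) (s : Set (Fin 5)) (hgs : g ∈ Ideal.span (X '' s : Set (MvPolynomial (Fin 5) k)))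
    (i : Fin 5) : Ideal.Quotient.mk (Ideal.span {g}) (X i) ∈ Ideal.span ((fun j : Fin 5 => Ideal.Quotient.mk (Ideal.span {g}) (X j)) '' s) ↔ i ∈ s := by
  refine ⟨fun h => ?_, fun hi => Ideal.subset_span ⟨i, hi, rfl⟩⟩
  rw [span_image_mk_eq_map] at h
  have h' : (X i : MvPolynomial (Fin 5) k) ∈ ((Ideal.span (X '' s : Set (MvPolynomial (Fin 5) k))).map (Ideal.Quotient.mk (Ideal.span {g}))).comap
      (Ideal.Quotient.mk (Ideal.span {g})) := Ideal.mem_comap.mpr h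
  rw [Ideal.comap_map_of_surjective _ Ideal.Quotient.mk_surjective, ← RingHom.ker_eq_comap_bot, Ideal.mk_ker,
    sup_eq_left.mpr ((Ideal.span_le.mpr (Set.singleton_subset_iff.mpr hgs)))] at h'
  exact Literature.RingTheory.MvPolynomial.X_mem_span_X_image_iff.mp h'

/-- ★ **`height 𝔮 = 2`**: `𝔮` is minimal over `(x̄, ȳ)` (`z̄² ∈ (x̄)`), so `height 𝔮 ≤ 2` (Krull); and `⊥ < (x̄, z̄) < 𝔮` are primes of the domain `A`.
[cite: Matsumura1987, Thm. 13.5] -/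
theorem height_centre (g : MvPolynomial (Fin 5) k) (hg : g = X 4 ^ 2 + X 0 ^ 2 * X 1 * X 4 + X 0 * X 1 ^ 2 * X 2 ^ 3 + X 0 * X 1 ^ 2 * X 3 ^ 3 + X 0 * X 1 ^ 2) :
    (Ideal.span ((fun j : Fin 5 => Ideal.Quotient.mk (Ideal.span {g}) (X j)) '' (({0, 1, 4} : Finset (Fin 5)) : Set (Fin 5)))).height = 2 := by
  classical
  haveI := NonFullLoopFrame.isPrime_span_g5 k g hg
  haveI : IsDomain (MvPolynomial (Fin 5) k ⧸ Ideal.span {g}) := Ideal.Quotient.isDomain _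
  set mk : MvPolynomial (Fin 5) k →+* MvPolynomial (Fin 5) k ⧸ Ideal.span {g} := Ideal.Quotient.mk (Ideal.span {g}) with hmk
  haveI h𝔮 := NonFullLoopFrame.isPrime_centre k g hg
  haveI h𝔭 : (Ideal.span ((fun j : Fin 5 => mk (X j)) '' (({0, 4} : Finset (Fin 5)) : Set (Fin 5)))).IsPrime :=
    isPrime_span_image_mk k g _ (g₅_mem_span_X_image k g hg _ (by simp) (by simp))
  have hz2 := mk_X4_sq k g hg
  apply le_antisymm
  · -- `≤ 2`: minimal over `(x̄, ȳ)`
    have hmin : Ideal.span ((fun j : Fin 5 => mk (X j)) '' (({0, 1, 4} : Finset (Fin 5)) : Set (Fin 5))) ∈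
        (Ideal.span (({mk (X 0), mk (X 1)} : Finset (MvPolynomial (Fin 5) k ⧸ Ideal.span {g})) :
          Set (MvPolynomial (Fin 5) k ⧸ Ideal.span {g}))).minimalPrimes := by
      refine ⟨⟨h𝔮, ?_⟩, ?_⟩
      · rw [Finset.coe_insert, Finset.coe_singleton, Ideal.span_le]
        rintro r hr
        rcases hr with rfl | rfl
        · exact Ideal.subset_span ⟨0, by simp, rfl⟩
        · exact Ideal.subset_span ⟨1, by simp, rfl⟩
      · rintro q ⟨hq, hxq⟩ hq𝔮
        rw [Finset.coe_insert, Finset.coe_singleton, Ideal.span_le] at hxq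
        have hx : mk (X 0) ∈ q := hxq (Or.inl rfl)
        have hy : mk (X 1) ∈ q := hxq (Or.inr rfl)
        have hz : mk (X 4) ∈ q := by
          apply hq.mem_of_pow_mem 2
          rw [hz2]
          exact Ideal.sub_mem _ (Submodule.neg_mem _ (Ideal.mul_mem_right _ _ (Ideal.mul_mem_right _ _ (Ideal.pow_mem_of_mem _ hx 2 two_pos))))
            (Ideal.mul_mem_right _ _ (Ideal.mul_mem_right _ _ hx))
        rw [Ideal.span_le]
        rintro _ ⟨j, hj, rfl⟩
        simp only [Finset.coe_insert, Finset.coe_singleton, Set.mem_insert_iff, Set.mem_singleton_iff] at hj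
        rcases hj with rfl | rfl | rfl
        · exact hx
        · exact hy
        · exact hz
    refine (Ideal.height_le_card_of_mem_minimalPrimes_span_finset hmin).trans ?_
    exact_mod_cast Finset.card_le_two
  · -- `≥ 2`: `⊥ < (x̄, z̄) < 𝔮`
    have hX0 : mk (X 0) ≠ 0 := fun h0 =>
      PrimeTransfer.X_not_mem_span_of_isPrime (i := 0) (NonFullLoopFrame.isPrime_span_g5 k g hg)
        (fun h => not_X_dvd_g₅ k g hg 0 (Ideal.mem_span_singleton.mp h)) (Ideal.Quotient.eq_zero_iff_mem.mp h0)
    have h𝔭0 : Ideal.span ((fun j : Fin 5 => mk (X j)) '' (({0, 4} : Finset (Fin 5)) : Set (Fin 5))) ≠ ⊥ := fun hbot =>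
      hX0 ((Submodule.eq_bot_iff _).mp hbot _ (Ideal.subset_span ⟨0, by simp, rfl⟩))
    have h1 : (1 : ℕ∞) ≤ (Ideal.span ((fun j : Fin 5 => mk (X j)) '' (({0, 4} : Finset (Fin 5)) : Set (Fin 5)))).height := by
      rw [Order.one_le_iff_ne_zero, Ne, Ideal.height_eq_zero_iff_eq_bot]
      exact h𝔭0
    have hlt : Ideal.span ((fun j : Fin 5 => mk (X j)) '' (({0, 4} : Finset (Fin 5)) : Set (Fin 5))) <
        Ideal.span ((fun j : Fin 5 => mk (X j)) '' (({0, 1, 4} : Finset (Fin 5)) : Set (Fin 5))) := by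
      refine lt_of_le_of_ne (Ideal.span_mono (Set.image_mono (by simp))) fun heq => ?_
      have hy : mk (X 1) ∈ Ideal.span ((fun j : Fin 5 => mk (X j)) '' (({0, 1, 4} : Finset (Fin 5)) : Set (Fin 5))) :=
        Ideal.subset_span ⟨1, by simp, rfl⟩
      rw [← heq, mk_X_mem_span_image_iff k g _ (g₅_mem_span_X_image k g hg _ (by simp) (by simp))] at hy
      simp at hy
    have h2 := Ideal.height_strict_mono_of_isPrime_of_isPrime hlt
    have hne : (Ideal.span ((fun j : Fin 5 => mk (X j)) '' (({0, 4} : Finset (Fin 5)) : Set (Fin 5)))).height ≠ ⊤ :=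
      Ideal.height_ne_top Ideal.IsPrime.ne_top'
    calc (2 : ℕ∞) = 1 + 1 := by norm_num
      _ ≤ (Ideal.span ((fun j : Fin 5 => mk (X j)) '' (({0, 4} : Finset (Fin 5)) : Set (Fin 5)))).height + 1 := add_le_add h1 le_rfl
      _ ≤ _ := (ENat.add_one_le_iff hne).mpr h2

/-! ## §3 ★★ The local ring at the centre is two-dimensional and NOT FULL (any field) -/

set_option maxHeartbeats 800000 in
-- one localization lift into `Frac(k[X])[ε]` + several ideal-membership computations (same budget as `TauFloorOneCIChartNotFull.not_fullCl_atPrime_primeXYZ`)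
/-- ★★ **`¬ FullCl 2 (A_𝔮)` AT THE GENERIC POINT `𝔮 = (x̄, ȳ, z̄)` OF THE CENTRE** (ANY field `k`): `dim A_𝔮 = 2`; `(x̄, ȳ)` is a system of parameters
(`z̄² ∈ (x̄)`); `z̄² = x̄²·(−ȳz̄) + ȳ²·(−x̄(ū³+t̄³+1)) ∈ (x̄, ȳ)^{[2]}`; but `z̄ ∉ (x̄, ȳ)A_𝔮` — the map `A_𝔮 → F[ε]`, `F = Frac k[X]`, `x, y ↦ 0`, `z ↦ ε`,
`u, t ↦ u, t` kills `g₅` and `(x̄, ȳ)` and sends `z̄` to `ε ≠ 0` (elements off `𝔮` go to units). So the Frobenius-closure clause of `FullCl 2` fails for the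
parameter ideal `(x̄, ȳ)`. [OURS · certificate; cite: Fedder1983, Prop. 1.7 (context)] -/
theorem not_fullCl_atPrime_centre (g : MvPolynomial (Fin 5) k)
    (hg : g = X 4 ^ 2 + X 0 ^ 2 * X 1 * X 4 + X 0 * X 1 ^ 2 * X 2 ^ 3 + X 0 * X 1 ^ 2 * X 3 ^ 3 + X 0 * X 1 ^ 2)
    (Q : Ideal (MvPolynomial (Fin 5) k ⧸ Ideal.span {g})) [Q.IsPrime]
    (hQ : Q = Ideal.span ((fun j : Fin 5 => Ideal.Quotient.mk (Ideal.span {g}) (X j)) '' (({0, 1, 4} : Finset (Fin 5)) : Set (Fin 5)))) :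
    ¬ FullCl 2 (Localization.AtPrime Q) := by
  intro hfull
  set R := MvPolynomial (Fin 5) k ⧸ Ideal.span {g} with hR
  set mk : MvPolynomial (Fin 5) k →+* R := Ideal.Quotient.mk (Ideal.span {g}) with hmk
  set L := Localization.AtPrime Q with hL
  set alg : R →+* L := algebraMap R L with halg
  -- (1) the dimension
  have hdim : ringKrullDim L = (2 : ℕ) := by
    rw [IsLocalization.AtPrime.ringKrullDim_eq_height Q L, hQ, height_centre k g hg]
    rfl
  -- (2) the system of parameters `(x̄, ȳ)`
  set s : Fin 2 → L := ![alg (mk (X 0)), alg (mk (X 1))] with hs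
  have hx0 : alg (mk (X 0)) ∈ Ideal.span (Set.range s) := Ideal.subset_span ⟨0, rfl⟩
  have hx1 : alg (mk (X 1)) ∈ Ideal.span (Set.range s) := Ideal.subset_span ⟨1, rfl⟩
  have hz2 : alg (mk (X 4)) ^ 2 = alg (mk (X 0)) ^ 2 * (-(alg (mk (X 1)) * alg (mk (X 4)))) +
      alg (mk (X 1)) ^ 2 * (-(alg (mk (X 0)) * (alg (mk (X 2)) ^ 3 + alg (mk (X 3)) ^ 3 + 1))) := by
    have h := congrArg alg (mk_X4_sq k g hg)
    simp only [map_pow, map_sub, map_neg, map_mul, map_add, map_one] at h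
    rw [h]; ring
  have hz2mem : alg (mk (X 4)) ^ 2 ∈ Ideal.span (Set.range s) := by
    rw [hz2]
    exact Ideal.add_mem _ (Ideal.mul_mem_right _ _ (Ideal.pow_mem_of_mem _ hx0 2 two_pos)) (Ideal.mul_mem_right _ _ (Ideal.pow_mem_of_mem _ hx1 2 two_pos))
  have hmaxL : IsLocalRing.maximalIdeal L = Q.map alg := (Localization.AtPrime.map_eq_maximalIdeal (I := Q)).symm
  have hle : Ideal.span (Set.range s) ≤ IsLocalRing.maximalIdeal L := by
    rw [Ideal.span_le]
    rintro _ ⟨j, rfl⟩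
    rw [hmaxL]
    fin_cases j
    · exact Ideal.mem_map_of_mem _ (by rw [hQ]; exact Ideal.subset_span ⟨0, by simp, rfl⟩)
    · exact Ideal.mem_map_of_mem _ (by rw [hQ]; exact Ideal.subset_span ⟨1, by simp, rfl⟩)
  have hrad_eq : (Ideal.span (Set.range s)).radical = IsLocalRing.maximalIdeal L := by
    apply le_antisymm
    · exact (Ideal.radical_mono hle).trans_eq (IsLocalRing.maximalIdeal.isMaximal L).isPrime.radical
    · rw [hmaxL]
      refine Ideal.map_le_iff_le_comap.mpr fun q hq => ?_
      rw [hQ] at hq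
      refine (Ideal.span_le.mpr ?_) hq
      rintro _ ⟨j, hj, rfl⟩
      simp only [Finset.coe_insert, Finset.coe_singleton, Set.mem_insert_iff, Set.mem_singleton_iff] at hj
      rw [SetLike.mem_coe, Ideal.mem_comap]
      rcases hj with rfl | rfl | rfl
      · exact Ideal.le_radical hx0
      · exact Ideal.le_radical hx1
      · exact ⟨2, hz2mem⟩
  have hrad : (Ideal.span (Set.range s)).radical.IsMaximal := by
    rw [hrad_eq]; exact IsLocalRing.maximalIdeal.isMaximal L
  -- (3) the Frobenius-closure clause of `FullCl 2` at `y = z̄`, `e = 1`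
  obtain ⟨-, hclause⟩ := hfull
  have hF3 := (hclause 2 hdim s hrad).2 (alg (mk (X 4))) ⟨1, by
    rw [pow_one, hz2]
    exact Ideal.add_mem _ (Ideal.mul_mem_right _ _ (Ideal.subset_span ⟨alg (mk (X 0)), hx0, rfl⟩))
      (Ideal.mul_mem_right _ _ (Ideal.subset_span ⟨alg (mk (X 1)), hx1, rfl⟩))⟩
  -- (4) `z̄ ∉ (x̄, ȳ) A_𝔮`: evaluate into the dual numbers over `F = Frac k[X]`
  let Fr := FractionRing (MvPolynomial (Fin 5) k)
  let ι : MvPolynomial (Fin 5) k →+* Fr := algebraMap _ _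
  let f : k →+* Fr[ε] := (TrivSqZeroExt.inlHom Fr Fr).comp (ι.comp MvPolynomial.C)
  let v : Fin 5 → Fr[ε] := fun j => if j = 4 then ε else if j = 0 ∨ j = 1 then 0 else TrivSqZeroExt.inl (ι (X j))
  have hv4 : v 4 = ε := by simp [v]
  have hv0 : v 0 = 0 := by simp [v]
  have hv1 : v 1 = 0 := by simp [v]
  have hε2 : (ε : Fr[ε]) ^ 2 = 0 := by rw [pow_two, DualNumber.eps_mul_eps]
  have hφg : eval₂Hom f v g = 0 := by
    rw [hg]
    simp only [map_add, map_mul, map_pow, eval₂Hom_X', hv4, hv0, hv1, hε2, zero_pow two_ne_zero, zero_mul, mul_zero, add_zero]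
  let φ₁ : R →+* Fr[ε] := Ideal.Quotient.lift (Ideal.span {g}) (eval₂Hom f v) fun a ha => by
    obtain ⟨c, rfl⟩ := Ideal.mem_span_singleton'.mp ha
    rw [map_mul, hφg, mul_zero]
  have hφ₁ : ∀ q : MvPolynomial (Fin 5) k, φ₁ (mk q) = eval₂Hom f v q := fun q => Ideal.Quotient.lift_mk _ _ _
  -- the first component of `eval₂Hom f v` is `ι ∘ (x, y, z ↦ 0)`
  have hfst : ∀ q : MvPolynomial (Fin 5) k, TrivSqZeroExt.fst (eval₂Hom f v q) =
      ι (aeval (fun i : Fin 5 => if i ∈ ((({0, 1, 4} : Finset (Fin 5)) : Set (Fin 5))) then (0 : MvPolynomial (Fin 5) k) else X i) q) := by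
    intro q
    have hcomp : (TrivSqZeroExt.fstHom Fr Fr Fr).toRingHom.comp (eval₂Hom f v) =
        ι.comp (aeval (fun i : Fin 5 => if i ∈ ((({0, 1, 4} : Finset (Fin 5)) : Set (Fin 5))) then (0 : MvPolynomial (Fin 5) k) else X i)).toRingHom := by
      refine MvPolynomial.ringHom_ext (fun a => ?_) (fun j => ?_)
      · simp [f, TrivSqZeroExt.inlHom]
      · fin_cases j <;> simp [v]
    have h1 := RingHom.congr_fun hcomp q
    change TrivSqZeroExt.fst (eval₂Hom f v q) = ι (aeval _ q) at h1
    exact h1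
  have hunit : ∀ y : Q.primeCompl, IsUnit (φ₁ y) := by
    rintro ⟨y, hy'⟩
    obtain ⟨q, rfl⟩ := Ideal.Quotient.mk_surjective y
    change IsUnit (φ₁ (mk q))
    rw [hφ₁, TrivSqZeroExt.isUnit_iff_isUnit_fst, hfst, isUnit_iff_ne_zero]
    intro hc
    apply hy'
    have hc' : aeval (fun i : Fin 5 => if i ∈ ((({0, 1, 4} : Finset (Fin 5)) : Set (Fin 5))) then (0 : MvPolynomial (Fin 5) k) else X i) q = 0 :=
      (IsFractionRing.injective (MvPolynomial (Fin 5) k) Fr) (by rw [map_zero]; exact hc)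
    have hq : q ∈ Ideal.span (X '' ((({0, 1, 4} : Finset (Fin 5)) : Set (Fin 5))) : Set (MvPolynomial (Fin 5) k)) := by
      rw [← Literature.RingTheory.MvPolynomial.ker_aeval_ite_eq_span]; exact hc'
    have := Ideal.mem_map_of_mem mk hq
    rw [← span_image_mk_eq_map] at this
    change mk q ∈ Q
    rw [hQ]; exact this
  let ψ : L →+* Fr[ε] := IsLocalization.lift (M := Q.primeCompl) (g := φ₁) hunit
  have hψ : ∀ r : R, ψ (alg r) = φ₁ r := fun r => IsLocalization.lift_eq (M := Q.primeCompl) hunit r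
  -- `ψ` kills `(s) = (x̄, ȳ)` …
  have hψs : ∀ w ∈ Ideal.span (Set.range s), ψ w = 0 := by
    intro w hw
    have hmap : Ideal.span (Set.range s) ≤ RingHom.ker ψ := by
      rw [Ideal.span_le]
      rintro _ ⟨j, rfl⟩
      rw [SetLike.mem_coe, RingHom.mem_ker, hs]
      fin_cases j
      · change ψ (alg (mk (X 0))) = 0
        rw [hψ, hφ₁, eval₂Hom_X', hv0]
      · change ψ (alg (mk (X 1))) = 0
        rw [hψ, hφ₁, eval₂Hom_X', hv1]
    exact hmap hw
  -- … but not `z̄ ↦ ε`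
  have hε : ψ (alg (mk (X 4))) = ε := by
    rw [hψ, hφ₁, eval₂Hom_X', hv4]
  have h0 := hψs _ hF3
  rw [hε] at h0
  have := congrArg TrivSqZeroExt.snd h0
  rw [DualNumber.snd_eps, TrivSqZeroExt.snd_zero] at this
  exact one_ne_zero this

/-! ## §4 ★★ Every point of `V(x̄, ȳ, z̄) ⊂ U₀` is NON-FULL (the «⊇» half of `hlocus`) -/

/-- ★★ **`¬ FullCl 2 (A_P)` for EVERY prime `P ⊇ 𝔮`** (`char k = 2`): FULL at `P` would localize to FULL at `𝔮 ⊆ P` (`ClauseOfMaximal.fiClause_atPrime_of_le`),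
contradicting §3. [OURS · certificate] -/
theorem not_fullCl_localization_of_centre_le [CharP k 2] (g : MvPolynomial (Fin 5) k)
    (hg : g = X 4 ^ 2 + X 0 ^ 2 * X 1 * X 4 + X 0 * X 1 ^ 2 * X 2 ^ 3 + X 0 * X 1 ^ 2 * X 3 ^ 3 + X 0 * X 1 ^ 2)
    (P : Ideal (MvPolynomial (Fin 5) k ⧸ Ideal.span {g})) [P.IsPrime]
    (hP : Ideal.span ((fun j : Fin 5 => Ideal.Quotient.mk (Ideal.span {g}) (X j)) '' (({0, 1, 4} : Finset (Fin 5)) : Set (Fin 5))) ≤ P) :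
    ¬ FullCl 2 (Localization.AtPrime P) := by
  haveI : Fact (Nat.Prime 2) := ⟨Nat.prime_two⟩
  haveI := NonFullLoopFrame.isPrime_span_g5 k g hg
  haveI : IsDomain (MvPolynomial (Fin 5) k ⧸ Ideal.span {g}) := Ideal.Quotient.isDomain _
  haveI : CharP (MvPolynomial (Fin 5) k ⧸ Ideal.span {g}) 2 := charP_of_injective_algebraMap (algebraMap k _).injective 2
  haveI := NonFullLoopFrame.isPrime_centre k g hg
  intro hfull
  exact not_fullCl_atPrime_centre k g hg _ rfl (ClauseOfMaximal.fiClause_atPrime_of_le 2 hP hfull)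

/-- ★★ **THE «⊇» HALF OF THE FLOOR-5 LOCUS LEMMA** (stalk form, lead-1's letters): every point `w` of `U₀ = Spec k[X]/(g₅)` with `(x̄, ȳ, z̄) ≤ w` is NON-FULL
(`char k = 2`). [OURS · certificate] -/
theorem not_fullCl_stalk_of_centre_le [CharP k 2] (g : MvPolynomial (Fin 5) k)
    (hg : g = X 4 ^ 2 + X 0 ^ 2 * X 1 * X 4 + X 0 * X 1 ^ 2 * X 2 ^ 3 + X 0 * X 1 ^ 2 * X 3 ^ 3 + X 0 * X 1 ^ 2)
    (w : Spec (.of (MvPolynomial (Fin 5) k ⧸ Ideal.span {g})))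
    (hw : Ideal.span ((fun j : Fin 5 => Ideal.Quotient.mk (Ideal.span {g}) (X j)) '' (({0, 1, 4} : Finset (Fin 5)) : Set (Fin 5))) ≤ w.asIdeal) :
    ¬ FullCl 2 ((Spec (.of (MvPolynomial (Fin 5) k ⧸ Ideal.span {g}))).presheaf.stalk w) := fun hfull =>
  not_fullCl_localization_of_centre_le k g hg w.asIdeal hw
    (WFixAtNonClosedDimTwo.fullCl_of_ringEquiv 2 (Spec.stalkIso (.of _) w).commRingCatIsoToRingEquiv hfull)

end Summit.ResolutionOfSingularities.ResolutionOfSingularities.Theorems.FInjectiveMacaulayfication.NonFullLoopFloorFive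

end
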